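import Summits.HodgeConjecture.HodgeConjecture.Theorems.F0P6aSpecOrgansTTranslReduction
import HarnessLib

/-!
# `F0P6aSpecOrgansTQuotQuotSheet` — ★ RE-HOME of `Lines/F0_P6a_SpecOrgansT.lean` (tree sha16 8dca47ee93439c08, 1023 l.), PART 3 of 4 — tree lines :649–:908
See PART 1 `Theorems/F0P6aSpecOrgansTBlockT5.lean` for the full ★ re-home header and the original module docstring (verbatim there).  Same namespace (every
fully-qualified name unchanged); the scopes open at the cut are re-opened below with their `variable` ∕ `open` ∕ `set_option` ∕ `universe` lines replayed verbatim
from the tree, in order; the code after the replay block is the tree bytes :649–:908, untouched.  HC_CM is proved only modulo the 7 printed citations (2 remaining: hLiu418 = stmt-HodgeConjecture-24832, h413 = stmt-HodgeConjecture-24833) until rung 0 closes; a re-home is count-neutral.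
-/

-- ── replay of the scopes open at tree line :649 (verbatim) ──
set_option autoImplicit false
set_option linter.dupNamespace false
noncomputable section
universe u
namespace Summit.HodgeConjecture.HodgeConjecture.Cruxes.HLiu418.F0P6aLineSpecialisation
section Block_D6
open CategoryTheory CategoryTheory.Limits NumberField IsDedekindDomain MulAction AlgebraicGeometry
open scoped Matrix Polynomial Pointwise MonoidalCategory
open Literature.NumberTheory.GaloisRepresentations
open Literature.NumberTheory.Automorphic Literature.NumberTheory.Automorphic.UnitaryGroup
open Literature.AlgebraicGeometry.ShimuraVarieties.UnitaryCanonicalModel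
open Literature.NumberTheory.Automorphic.Liu2021.AppendixC
open Literature.AlgebraicGeometry.Motives (AlgPoints IntegralModel SchemeOver thickening thickeningGalAction thickeningLift specOver)
open Literature.NumberTheory.DiophantineGeometry (geomResidueField specialFibreFunctor specResidueField)
open Literature.AlgebraicGeometry.RelativeSpec (ActionOver)
open Literature.AlgebraicGeometry.AbelianSchemes Literature.AlgebraicGeometry.AbelianSchemes.AbelianSchemeOver
open Literature.AlgebraicGeometry.GroupSchemes.AffineGroupScheme (Alg quotIncl)
open Summit.HodgeConjecture.HodgeConjecture.Cruxes.HLiu418.F0P6aModuliDatumDefs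
open Summit.HodgeConjecture.HodgeConjecture.Cruxes.HLiu418.F0P6aRGDAssembly
open Summit.HodgeConjecture.HodgeConjecture.Cruxes.HLiu418.F0P6aDatumOfInputs
section QuotQuotSheet
open scoped MonObj CategoryTheory.Obj
set_option backward.isDefEq.respectTransparency false
variable {F : Type} [Field F] [NumberField F] [IsCMField F] {ι₁ : F →+* ℂ}
    {Jstar : Matrix (Fin 2) (Fin 2) F}
    {K₀ : C5.OpenCompactSubgroup ↥(finAdelic ↥(maximalRealSubfield F) F (IsCMField.complexConj F) 2 Jstar)}
    {S : RecordSystemGS F Jstar ι₁ K₀} {hU7ₛ : S.HeckeTranslateDefinedOver}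
    {hJ : (Jstar.map (IsCMField.complexConj F))ᵀ = Jstar} {hJu : IsUnit Jstar}
    {Fi : Type} [Field Fi] [Algebra F Fi] {Kc : C5.SmallLevel K₀} {G : Type} [Group G]
    {𝓜 : IntegralModel (𝓞 F) F ((thickening F Fi).obj (S.M.obj Kc))}
    {w : HeightOneSpectrum (𝓞 F)} {hw : (IsCMField.complexConj F) • w ≠ w} {h𝓨 : (𝓜.localise w).IsSmoothProper 1}
    {θ : ActionOver (𝓜.localise w).total.hom ((Fi ≃ₐ[F] Fi) × G)}
    {e : Fi →ₐ[F] AlgebraicClosure (w.adicCompletion F)}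

set_option maxHeartbeats 400000 in
/-- **LINE UNIQUENESS BELOW THE KERNEL OF A LAYER MAP OVER A `𝒞`-LEG, AT THE DOCKS** (step (1)–(2a) of D6): at `x̄ := red₀ y`, `x̄″ := red₀ (quotΩ y L)`, for a homomorphic
layer map `φ : G₀(x̄) → G₀(x̄″)` OVER a reduced leg `ψ : A_{x̄} → 𝒞_{x̄″}` through the monomorphic cover pin `ι₀G(x̄″) ≫ c̄_{x̄″}` (`hover`), where `ψ` meets the dock
EXACTLY in `V(spGeoOf I 𝔡 y L)` (`hdock`, the (ρ1𝒞) (DOCK) row VERBATIM): every `H′ : SubOf I 𝔡 x̄″` below `ker Γ(φ)` EQUALS any named `sp (quotΩ y L) L_b` below `ker Γ(φ)`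
— both values are `ker Γ(φ)` by ★ (ρ3a) `eq_ker_appTop_of_admissible_of_le_of_over` (source rank `q·q` = `(𝔡 x̄).hrkG₀`, kernel corank `q` = admissibility of `spGeoOf I 𝔡 y L`)
— so a second lift `(y₂, L₂)` of `(x̄″, H′)` specialises, after the cast along `red₀ y₂ = x̄″`, to `sp (quotΩ y L) L_b`.
[cite: Milne2017, Ch. 11 §b Prop. 11.10; Ch. 3 §b Prop. 3.15] [cite: Tate1997FiniteFlatGroupSchemes, (3.7)] [cite: Liu2021, Prop. D.8 (2) p. 135, p. 137] -/
theorem spGeoOf_cast_eq_of_le_ker_layer (I : RGDInputsAt F ι₁ Jstar K₀ S hU7ₛ hJ hJu Fi Kc G 𝓜 w hw h𝓨 θ e) [ExpChar (geomResidueField w) I.pChar]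
    {m : ℕ} (E' : Matrix (Fin m) (Fin m) (𝓞 F)) (hE' : E' * E' = E') (P : Matrix (Fin m) (Fin 1) (𝓞 F))
    (𝔡 : ∀ xbar, DockAt I xbar)
    (quotΩ : ∀ y, LineOf I y → AlgPoints (S.M.obj Kc) (AlgebraicClosure (w.adicCompletion F)))
    (y : AlgPoints (S.M.obj Kc) (AlgebraicClosure (w.adicCompletion F))) (L : LineOf I y)
    -- the reduced `𝒞`-leg at `(y, L)` ((ρ1𝒞)) with its (DOCK) row VERBATIM
    (ψ : haveI := I.comm
      (sch₀Of 𝓜 w I.univ (red₀Of S Kc 𝓜 w h𝓨 e y)).X ⟶ (sch₀Of 𝓜 w (serreTensor I.act E' hE') (red₀Of S Kc 𝓜 w h𝓨 e (quotΩ y L))).X)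
    (hdock : letI := (𝔡 (red₀Of S Kc 𝓜 w h𝓨 e y)).grp₀; haveI := (𝔡 (red₀Of S Kc 𝓜 w h𝓨 e y)).aff₀;
      ∀ ⦃T : SchemeOver (geomResidueField w)⦄ (t : T ⟶ (𝔡 (red₀Of S Kc 𝓜 w h𝓨 e y)).G₀),
        t ≫ (𝔡 (red₀Of S Kc 𝓜 w h𝓨 e y)).ι₀G ≫ ψ = 1 ↔
          ∃ s : T ⟶ specOver (geomResidueField w) (Alg (𝔡 (red₀Of S Kc 𝓜 w h𝓨 e y)).G₀ ⧸ (spGeoOf I 𝔡 y L).1),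
            s ≫ quotIncl (𝔡 (red₀Of S Kc 𝓜 w h𝓨 e y)).G₀ (spGeoOf I 𝔡 y L).1 = t)
    -- the layer map OVER `ψ` THROUGH THE COVER PIN ((ρ3-K)), a homomorphism; the pin a monomorphism (`mono_coverPin₀`)
    (φ : (𝔡 (red₀Of S Kc 𝓜 w h𝓨 e y)).G₀ ⟶ (𝔡 (red₀Of S Kc 𝓜 w h𝓨 e (quotΩ y L))).G₀)
    (hφ : letI := (𝔡 (red₀Of S Kc 𝓜 w h𝓨 e y)).grp₀; letI := (𝔡 (red₀Of S Kc 𝓜 w h𝓨 e (quotΩ y L))).grp₀; IsMonHom φ)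
    (hpin : haveI := I.comm
      Mono ((𝔡 (red₀Of S Kc 𝓜 w h𝓨 e (quotΩ y L))).ι₀G ≫
        baseChangeHom (baseChangeHom (serreTranslate I.act E' hE' P) (pullback.fst (𝓜.localise w).total.hom (specResidueField w))) (red₀Of S Kc 𝓜 w h𝓨 e (quotΩ y L)).left))
    (hover : haveI := I.comm
      φ ≫ (𝔡 (red₀Of S Kc 𝓜 w h𝓨 e (quotΩ y L))).ι₀G ≫
          baseChangeHom (baseChangeHom (serreTranslate I.act E' hE' P) (pullback.fst (𝓜.localise w).total.hom (specResidueField w))) (red₀Of S Kc 𝓜 w h𝓨 e (quotΩ y L)).left =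
        (𝔡 (red₀Of S Kc 𝓜 w h𝓨 e y)).ι₀G ≫ ψ)
    -- the NAMED line below the kernel
    (Lb : LineOf I (quotΩ y L))
    (hLb : letI := (𝔡 (red₀Of S Kc 𝓜 w h𝓨 e (quotΩ y L))).grp₀; haveI := (𝔡 (red₀Of S Kc 𝓜 w h𝓨 e (quotΩ y L))).aff₀;
      (spGeoOf I 𝔡 (quotΩ y L) Lb).1 ≤ (RingHom.ker φ.left.appTop.hom : Ideal (Alg (𝔡 (red₀Of S Kc 𝓜 w h𝓨 e (quotΩ y L))).G₀)))
    -- D6's hypothesis letter and a second lift of `(x̄″, H′)`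
    (H' : SubOf I 𝔡 (red₀Of S Kc 𝓜 w h𝓨 e (quotΩ y L)))
    (hle : letI := (𝔡 (red₀Of S Kc 𝓜 w h𝓨 e (quotΩ y L))).grp₀; haveI := (𝔡 (red₀Of S Kc 𝓜 w h𝓨 e (quotΩ y L))).aff₀;
      H'.1 ≤ (RingHom.ker φ.left.appTop.hom : Ideal (Alg (𝔡 (red₀Of S Kc 𝓜 w h𝓨 e (quotΩ y L))).G₀)))
    (y₂ : AlgPoints (S.M.obj Kc) (AlgebraicClosure (w.adicCompletion F))) (L₂ : LineOf I y₂)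
    (h₂ : red₀Of S Kc 𝓜 w h𝓨 e y₂ = red₀Of S Kc 𝓜 w h𝓨 e (quotΩ y L)) (hsp₂ : h₂ ▸ spGeoOf I 𝔡 y₂ L₂ = H') :
    h₂ ▸ spGeoOf I 𝔡 y₂ L₂ = spGeoOf I 𝔡 (quotΩ y L) Lb := by
  haveI := I.comm
  letI := (𝔡 (red₀Of S Kc 𝓜 w h𝓨 e y)).grp₀
  letI := (𝔡 (red₀Of S Kc 𝓜 w h𝓨 e (quotΩ y L))).grp₀
  haveI := (𝔡 (red₀Of S Kc 𝓜 w h𝓨 e y)).aff₀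
  haveI := (𝔡 (red₀Of S Kc 𝓜 w h𝓨 e (quotΩ y L))).aff₀
  haveI := (𝔡 (red₀Of S Kc 𝓜 w h𝓨 e (quotΩ y L))).hι₀G.1
  haveI := hφ
  haveI := hpin
  haveI := isMonHom_coverLeg (pullback.fst (𝓜.localise w).total.hom (specResidueField w)) (red₀Of S Kc 𝓜 w h𝓨 e (quotΩ y L)).left I.act E' hE' P
  haveI : IsFinite (𝔡 (red₀Of S Kc 𝓜 w h𝓨 e y)).G₀.hom := (𝔡 (red₀Of S Kc 𝓜 w h𝓨 e y)).fin₀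
  haveI : IsFinite (𝔡 (red₀Of S Kc 𝓜 w h𝓨 e (quotΩ y L))).G₀.hom := (𝔡 (red₀Of S Kc 𝓜 w h𝓨 e (quotΩ y L))).fin₀
  haveI := Literature.AlgebraicGeometry.GroupSchemes.AffineGroupScheme.Alg.moduleFinite (𝔡 (red₀Of S Kc 𝓜 w h𝓨 e y)).G₀
  haveI := Literature.AlgebraicGeometry.GroupSchemes.AffineGroupScheme.Alg.moduleFinite (𝔡 (red₀Of S Kc 𝓜 w h𝓨 e (quotΩ y L))).G₀
  -- (1) both admissible ideals below the kernel ARE the kernel ideal (★ (ρ3a))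
  have hH' : H'.1 = (RingHom.ker φ.left.appTop.hom : Ideal (Alg (𝔡 (red₀Of S Kc 𝓜 w h𝓨 e (quotΩ y L))).G₀)) :=
    Literature.AlgebraicGeometry.GroupSchemes.AffineGroupScheme.eq_ker_appTop_of_admissible_of_le_of_over φ ψ
      (𝔡 (red₀Of S Kc 𝓜 w h𝓨 e y)).ι₀G _ hover (spGeoOf I 𝔡 y L).1 (𝔡 (red₀Of S Kc 𝓜 w h𝓨 e y)).hrkG₀ (spGeoOf I 𝔡 y L).2.2.1 hdock
      (𝔡 (red₀Of S Kc 𝓜 w h𝓨 e (quotΩ y L))).β₀ H' hle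
  have hLb' : (spGeoOf I 𝔡 (quotΩ y L) Lb).1 = (RingHom.ker φ.left.appTop.hom : Ideal (Alg (𝔡 (red₀Of S Kc 𝓜 w h𝓨 e (quotΩ y L))).G₀)) :=
    Literature.AlgebraicGeometry.GroupSchemes.AffineGroupScheme.eq_ker_appTop_of_admissible_of_le_of_over φ ψ
      (𝔡 (red₀Of S Kc 𝓜 w h𝓨 e y)).ι₀G _ hover (spGeoOf I 𝔡 y L).1 (𝔡 (red₀Of S Kc 𝓜 w h𝓨 e y)).hrkG₀ (spGeoOf I 𝔡 y L).2.2.1 hdock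
      (𝔡 (red₀Of S Kc 𝓜 w h𝓨 e (quotΩ y L))).β₀ (spGeoOf I 𝔡 (quotΩ y L) Lb) hLb
  -- (2a) hence the second lift's line specialises to `sp (quotΩ y L) L_b`
  exact hsp₂.trans (Subtype.ext (hH'.trans hLb'.symm))

set_option maxHeartbeats 400000 in
/-- **D6 ON THE `e`-SHEET, TWO-LIFT FORM — `quot ∘ quot = transl` DOWNSTAIRS: `red₀ (quotΩ y₂ L₂) = red₀ (translΩ y)`.**  Inputs BY NAME: the reduced `𝒞`-leg `ψ` at
`(y, L)` with its (DOCK) row ((ρ1𝒞)), a homomorphic layer map `φ` over `ψ` through the monomorphic cover pin ((ρ3-K)), a line `L_b` at `quotΩ y L` whose specialisation lies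
below `ker Γ(φ)` ((IMG) + (ρ3-K) `le_ker_isogW₀_of_himg`) and which BACKTRACKS `quotΩ (quotΩ y L) L_b = translΩ y` ((H4′)∕★ HBT `exists_line_quotΩ_quotΩ_eq_translΩ_of_hecke_of_hyperspecial`),
and [WQ] «the reduced moduli quotient depends only on `(red₀ y, sp y L)`» in its two-lift form (the (C6α) fold).  Then for D6's letter `H′ ≤ ker Γ(φ)` and ANY second lift
`(y₂, L₂)` of `(red₀ (quotΩ y L), H′)`: `red₀ (quotΩ y₂ L₂) = red₀ (translΩ y)` — line uniqueness (`spGeoOf_cast_eq_of_le_ker_layer`) + [WQ] at `(y₂, quotΩ y L)` + the backtrack.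
The L2 head reads this as `quot (quot x̄ H) H′ = transl x̄` at `x̄ = red₀ y`, `H = sp y L` through `RedQuotLaw`∕`RedTranslLaw` (`SpSurjLaw` supplies `L₂`).
[cite: Liu2021, Prop. D.8 (2) p. 135, p. 137] [cite: Milne2017, Ch. 11 §b Prop. 11.10] [cite: ShimuraIATAF1971, Ch. 3 §3.3 Thm. 3.24 (2), (4)] -/
theorem red₀Of_quotΩ_eq_red₀Of_translΩ_of_le_ker_layer (I : RGDInputsAt F ι₁ Jstar K₀ S hU7ₛ hJ hJu Fi Kc G 𝓜 w hw h𝓨 θ e) [ExpChar (geomResidueField w) I.pChar]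
    {m : ℕ} (E' : Matrix (Fin m) (Fin m) (𝓞 F)) (hE' : E' * E' = E') (P : Matrix (Fin m) (Fin 1) (𝓞 F))
    (𝔡 : ∀ xbar, DockAt I xbar)
    (quotΩ : ∀ y, LineOf I y → AlgPoints (S.M.obj Kc) (AlgebraicClosure (w.adicCompletion F)))
    (translΩ : AlgPoints (S.M.obj Kc) (AlgebraicClosure (w.adicCompletion F)) → AlgPoints (S.M.obj Kc) (AlgebraicClosure (w.adicCompletion F)))
    -- [WQ] two-lift form for `sp := spGeoOf I 𝔡` (the (C6α) fold `red₀Of_quotΩ_eq_of_quotLegReduction₀` with its data fixed)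
    (hWQ : ∀ (y y' : AlgPoints (S.M.obj Kc) (AlgebraicClosure (w.adicCompletion F))) (L : LineOf I y) (L' : LineOf I y')
      (h : red₀Of S Kc 𝓜 w h𝓨 e y = red₀Of S Kc 𝓜 w h𝓨 e y'),
      h ▸ spGeoOf I 𝔡 y L = spGeoOf I 𝔡 y' L' → red₀Of S Kc 𝓜 w h𝓨 e (quotΩ y L) = red₀Of S Kc 𝓜 w h𝓨 e (quotΩ y' L'))
    (y : AlgPoints (S.M.obj Kc) (AlgebraicClosure (w.adicCompletion F))) (L : LineOf I y)
    -- the reduced `𝒞`-leg at `(y, L)` ((ρ1𝒞)) with its (DOCK) row VERBATIM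
    (ψ : haveI := I.comm
      (sch₀Of 𝓜 w I.univ (red₀Of S Kc 𝓜 w h𝓨 e y)).X ⟶ (sch₀Of 𝓜 w (serreTensor I.act E' hE') (red₀Of S Kc 𝓜 w h𝓨 e (quotΩ y L))).X)
    (hdock : letI := (𝔡 (red₀Of S Kc 𝓜 w h𝓨 e y)).grp₀; haveI := (𝔡 (red₀Of S Kc 𝓜 w h𝓨 e y)).aff₀;
      ∀ ⦃T : SchemeOver (geomResidueField w)⦄ (t : T ⟶ (𝔡 (red₀Of S Kc 𝓜 w h𝓨 e y)).G₀),
        t ≫ (𝔡 (red₀Of S Kc 𝓜 w h𝓨 e y)).ι₀G ≫ ψ = 1 ↔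
          ∃ s : T ⟶ specOver (geomResidueField w) (Alg (𝔡 (red₀Of S Kc 𝓜 w h𝓨 e y)).G₀ ⧸ (spGeoOf I 𝔡 y L).1),
            s ≫ quotIncl (𝔡 (red₀Of S Kc 𝓜 w h𝓨 e y)).G₀ (spGeoOf I 𝔡 y L).1 = t)
    -- the layer map OVER `ψ` THROUGH THE COVER PIN ((ρ3-K)), a homomorphism; the pin a monomorphism (`mono_coverPin₀`)
    (φ : (𝔡 (red₀Of S Kc 𝓜 w h𝓨 e y)).G₀ ⟶ (𝔡 (red₀Of S Kc 𝓜 w h𝓨 e (quotΩ y L))).G₀)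
    (hφ : letI := (𝔡 (red₀Of S Kc 𝓜 w h𝓨 e y)).grp₀; letI := (𝔡 (red₀Of S Kc 𝓜 w h𝓨 e (quotΩ y L))).grp₀; IsMonHom φ)
    (hpin : haveI := I.comm
      Mono ((𝔡 (red₀Of S Kc 𝓜 w h𝓨 e (quotΩ y L))).ι₀G ≫
        baseChangeHom (baseChangeHom (serreTranslate I.act E' hE' P) (pullback.fst (𝓜.localise w).total.hom (specResidueField w))) (red₀Of S Kc 𝓜 w h𝓨 e (quotΩ y L)).left))
    (hover : haveI := I.comm
      φ ≫ (𝔡 (red₀Of S Kc 𝓜 w h𝓨 e (quotΩ y L))).ι₀G ≫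
          baseChangeHom (baseChangeHom (serreTranslate I.act E' hE' P) (pullback.fst (𝓜.localise w).total.hom (specResidueField w))) (red₀Of S Kc 𝓜 w h𝓨 e (quotΩ y L)).left =
        (𝔡 (red₀Of S Kc 𝓜 w h𝓨 e y)).ι₀G ≫ ψ)
    -- the NAMED backtracking line: below the kernel ((IMG) + (ρ3-K)) and Hecke-backtracking ((H4′)∕★ HBT)
    (Lb : LineOf I (quotΩ y L))
    (hLb : letI := (𝔡 (red₀Of S Kc 𝓜 w h𝓨 e (quotΩ y L))).grp₀; haveI := (𝔡 (red₀Of S Kc 𝓜 w h𝓨 e (quotΩ y L))).aff₀;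
      (spGeoOf I 𝔡 (quotΩ y L) Lb).1 ≤ (RingHom.ker φ.left.appTop.hom : Ideal (Alg (𝔡 (red₀Of S Kc 𝓜 w h𝓨 e (quotΩ y L))).G₀)))
    (hbt : quotΩ (quotΩ y L) Lb = translΩ y)
    -- D6's hypothesis letter and a second lift of `(x̄″, H′)`
    (H' : SubOf I 𝔡 (red₀Of S Kc 𝓜 w h𝓨 e (quotΩ y L)))
    (hle : letI := (𝔡 (red₀Of S Kc 𝓜 w h𝓨 e (quotΩ y L))).grp₀; haveI := (𝔡 (red₀Of S Kc 𝓜 w h𝓨 e (quotΩ y L))).aff₀;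
      H'.1 ≤ (RingHom.ker φ.left.appTop.hom : Ideal (Alg (𝔡 (red₀Of S Kc 𝓜 w h𝓨 e (quotΩ y L))).G₀)))
    (y₂ : AlgPoints (S.M.obj Kc) (AlgebraicClosure (w.adicCompletion F))) (L₂ : LineOf I y₂)
    (h₂ : red₀Of S Kc 𝓜 w h𝓨 e y₂ = red₀Of S Kc 𝓜 w h𝓨 e (quotΩ y L)) (hsp₂ : h₂ ▸ spGeoOf I 𝔡 y₂ L₂ = H') :
    red₀Of S Kc 𝓜 w h𝓨 e (quotΩ y₂ L₂) = red₀Of S Kc 𝓜 w h𝓨 e (translΩ y) := by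
  have hsp : h₂ ▸ spGeoOf I 𝔡 y₂ L₂ = spGeoOf I 𝔡 (quotΩ y L) Lb :=
    spGeoOf_cast_eq_of_le_ker_layer I E' hE' P 𝔡 quotΩ y L ψ hdock φ hφ hpin hover Lb hLb H' hle y₂ L₂ h₂ hsp₂
  rw [← hbt]
  exact hWQ y₂ (quotΩ y L) L₂ Lb h₂ hsp

end QuotQuotSheet

end Block_D6


/-! ## §Q — [WQ] FOLD BY IMPORT — LA6-p01 (g3) `QuotWD.partC.v1` e6add853104d55b3 (= `QuotWD.fold.v5` 8cc947ce `section QuotWDFold` :1001–:1218 VERBATIM; GREEN+TRIO by import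
 on the served PART A + W1-b oleans 10:45:33Z, 249 s): `quotLegRows_at_of_eq` + HEAD `red₀Of_quotΩ_eq_of_quotLegReduction₀` = the LEAF's `stub_WQ` socket text (machine diff ∅, 10:01:02Z);
 W1-b `exists_roofMiddleDual₀` opened BY NAME from `…F0P6aStubFROBRoofMiddleDual`. Folded into PART B (LA2-plan (g2) 11:1xZ, LEAD «M-93∕pre» (c): an organ < 2 h from GREEN is
 folded PAID, not socketed) so that LEAF ED. 4 pays `stub_WQ` BY NAME and carries ONE named socket (`stub_RHO1`) only. -/

section Block_Q

open CategoryTheory CategoryTheory.Limits NumberField IsDedekindDomain MulAction AlgebraicGeometry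
open scoped Matrix Polynomial Pointwise MonoidalCategory
open Literature.NumberTheory.GaloisRepresentations
open Literature.NumberTheory.Automorphic Literature.NumberTheory.Automorphic.UnitaryGroup
open Literature.AlgebraicGeometry.ShimuraVarieties.UnitaryCanonicalModel
open Literature.NumberTheory.Automorphic.Liu2021.AppendixC
open Literature.AlgebraicGeometry.Motives (AlgPoints IntegralModel SchemeOver thickening thickeningGalAction thickeningLift specOver)
open Literature.NumberTheory.DiophantineGeometry (geomResidueField specialFibreFunctor specResidueField)
open Literature.AlgebraicGeometry.RelativeSpec (ActionOver)
open Literature.AlgebraicGeometry.AbelianSchemes Literature.AlgebraicGeometry.AbelianSchemes.AbelianSchemeOver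
open Literature.AlgebraicGeometry.GroupSchemes.AffineGroupScheme (Alg quotIncl)
open Summit.HodgeConjecture.HodgeConjecture.Cruxes.HLiu418.F0P6aModuliDatumDefs
open Summit.HodgeConjecture.HodgeConjecture.Cruxes.HLiu418.F0P6aRGDAssembly
open Summit.HodgeConjecture.HodgeConjecture.Cruxes.HLiu418.F0P6aDatumOfInputs
open Summit.HodgeConjecture.HodgeConjecture.Cruxes.HLiu418.F0P6aQuotientFibreEngineInputs

open Summit.HodgeConjecture.HodgeConjecture.Cruxes.HLiu418.F0P6aStubFROBRoofMiddleDual (exists_roofMiddleDual₀)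

/-! ### §2 THE [WQ] FOLD: (C6α-T) transport + HEAD (C6α) -/

section QuotWDFold

open scoped MonObj CategoryTheory.Obj

-- the frame of the D-line՚s `Letters` section VERBATIM
variable {F : Type} [Field F] [NumberField F] [IsCMField F] {ι₁ : F →+* ℂ}
    {Jstar : Matrix (Fin 2) (Fin 2) F}
    {K₀ : C5.OpenCompactSubgroup ↥(finAdelic ↥(maximalRealSubfield F) F (IsCMField.complexConj F) 2 Jstar)}
    {S : RecordSystemGS F Jstar ι₁ K₀} {hU7ₛ : S.HeckeTranslateDefinedOver}
    {hJ : (Jstar.map (IsCMField.complexConj F))ᵀ = Jstar} {hJu : IsUnit Jstar}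
    {Fi : Type} [Field Fi] [Algebra F Fi] {Kc : C5.SmallLevel K₀} {G : Type} [Group G]
    {𝓜 : IntegralModel (𝓞 F) F ((thickening F Fi).obj (S.M.obj Kc))}
    {w : HeightOneSpectrum (𝓞 F)} {hw : (IsCMField.complexConj F) • w ≠ w} {h𝓨 : (𝓜.localise w).IsSmoothProper 1}
    {θ : ActionOver (𝓜.localise w).total.hom ((Fi ≃ₐ[F] Fi) × G)}
    {e : Fi →ₐ[F] AlgebraicClosure (w.adicCompletion F)}

set_option maxHeartbeats 400000 in
set_option backward.isDefEq.respectTransparency false in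
/-- **(C6α-T) `quotLegRows_at_of_eq` — TRANSPORT OF THE REDUCED QUOTIENT DATUM ALONG `red₀ y = x̄`.**  The (ρ1𝒞) rows at `(y, L)` (target `𝒞_{red₀ y″}`, any `y″`;
(FLAT-SURJ)(ACT)(LVL)(SIM ∀-form)(K2-gen)(KILL)(DOCK) VERBATIM) hold at every special point `x̄` with `red₀ y = x̄`, with `spGeoOf I 𝔡 y L` replaced by its transport
`H := (red₀ y = x̄) ▸ spGeoOf I 𝔡 y L ∈ SubOf I 𝔡 x̄` (the dock `𝔡 x̄`, the carriers `sch₀Of ∕ act₀Of ∕ lvlPt₀Of ∕ pol₀Of ∕ dual₀Of` and the two dock clauses all ride the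
EQUATION BINDER; proof `subst; subst; exact` — D-line lesson (F1): point equalities are carried by binders, never by unification inside the tower).  This is step (1) of
the [WQ] fold: for `h : red₀ y = red₀ y′`, `hsp : h ▸ sp y L = sp y′ L′` both quotient legs leave the LITERAL source `A_{red₀ y′}` and read ONE dock ideal.
[cite: Liu2021, Prop. D.8 (2) p. 135, p. 137] [cite: SerreTate1968, §1 Lemma 2] -/
theorem quotLegRows_at_of_eq (I : RGDInputsAt F ι₁ Jstar K₀ S hU7ₛ hJ hJu Fi Kc G 𝓜 w hw h𝓨 θ e) [ExpChar (geomResidueField w) I.pChar]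
    {m : ℕ} (E' : Matrix (Fin m) (Fin m) (𝓞 F)) (hE' : E' * E' = E') (P : Matrix (Fin m) (Fin 1) (𝓞 F))
    (𝔡 : ∀ xbar, DockAt I xbar)
    (y : AlgPoints (S.M.obj Kc) (AlgebraicClosure (w.adicCompletion F))) (L : LineOf I y)
    (y'' : AlgPoints (S.M.obj Kc) (AlgebraicClosure (w.adicCompletion F)))
    (hdat :
      haveI := I.comm
      letI := (𝔡 (red₀Of S Kc 𝓜 w h𝓨 e y)).grp₀
      haveI := (𝔡 (red₀Of S Kc 𝓜 w h𝓨 e y)).aff₀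
        ∃ (ψ : (sch₀Of 𝓜 w I.univ (red₀Of S Kc 𝓜 w h𝓨 e y)).X ⟶ (sch₀Of 𝓜 w (serreTensor I.act E' hE') (red₀Of S Kc 𝓜 w h𝓨 e y'')).X) (_ : IsMonHom ψ),
          (Flat ψ.left ∧ Function.Surjective ψ.left.base) ∧
          (∀ a : 𝓞 F, (act₀Of 𝓜 w I.univ I.act a (red₀Of S Kc 𝓜 w h𝓨 e y)).hom.hom.hom ≫ ψ =
            ψ ≫ (act₀Of 𝓜 w (serreTensor I.act E' hE') (serreAction I.act E' hE') a (red₀Of S Kc 𝓜 w h𝓨 e y'')).hom.hom.hom) ∧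
          (∀ a : Fin I.g ⊕ Fin I.g → ZMod I.N,
            AlgPoints.map ψ (lvlPt₀Of 𝓜 w I.univ I.lvl (red₀Of S Kc 𝓜 w h𝓨 e y) a) =
              ((serreTensor I.act E' hE').baseChange (pullback.fst (𝓜.localise w).total.hom (specResidueField w))).restrictPt (red₀Of S Kc 𝓜 w h𝓨 e y'').left
                ((serreTensor I.act E' hE').sectionBaseChange (pullback.fst (𝓜.localise w).total.hom (specResidueField w)) (I.lvl.section_ a ≫ serreTranslate I.act E' hE' P))) ∧
          (∀ (DBs : (sch₀Of 𝓜 w (serreTensor I.act E' hE') (red₀Of S Kc 𝓜 w h𝓨 e y'')).DualPair)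
            (_ : Nonempty ((Scheme.Modules.pullback (DualPair.unitHatSlice DBs)).obj DBs.P ≅ SheafOfModules.unit _))
            (lamBs : (sch₀Of 𝓜 w (serreTensor I.act E' hE') (red₀Of S Kc 𝓜 w h𝓨 e y'')).X ⟶ DBs.hat.X) [IsMonHom lamBs],
            (haveI := isMonHom_coverLeg (pullback.fst (𝓜.localise w).total.hom (specResidueField w)) (red₀Of S Kc 𝓜 w h𝓨 e y'').left I.act E' hE' P
             baseChangeHom (baseChangeHom (serreTranslate I.act E' hE' P) (pullback.fst (𝓜.localise w).total.hom (specResidueField w))) (red₀Of S Kc 𝓜 w h𝓨 e y'').left ≫ lamBs ≫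
                DualPair.dualIsogenyOver (baseChangeHom (baseChangeHom (serreTranslate I.act E' hE' P) (pullback.fst (𝓜.localise w).total.hom (specResidueField w))) (red₀Of S Kc 𝓜 w h𝓨 e y'').left)
                  (dual₀Of 𝓜 w I.univ I.dual (red₀Of S Kc 𝓜 w h𝓨 e y'')) DBs =
              (pol₀Of 𝓜 w I.univ I.pol (red₀Of S Kc 𝓜 w h𝓨 e y'')).lam ≫ (dual₀Of 𝓜 w I.univ I.dual (red₀Of S Kc 𝓜 w h𝓨 e y'')).hat.mulN I.pChar) →
            ψ ≫ lamBs ≫ DualPair.dualIsogenyOver ψ (dual₀Of 𝓜 w I.univ I.dual (red₀Of S Kc 𝓜 w h𝓨 e y)) DBs =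
              (pol₀Of 𝓜 w I.univ I.pol (red₀Of S Kc 𝓜 w h𝓨 e y)).lam ≫ (dual₀Of 𝓜 w I.univ I.dual (red₀Of S Kc 𝓜 w h𝓨 e y)).hat.mulN I.pChar) ∧
          (∀ 𝔞 : Ideal (𝓞 F), (∀ Pt ∈ L.1, IsIdealTorsionΩ S Kc 𝓜 w e I.univ I.act y 𝔞 Pt) →
            (∀ Pt : (fibreΩOf S Kc 𝓜 w e I.univ y).Points (AlgebraicClosure (w.adicCompletion F)),
              (∀ r ∈ w.asIdeal * ((IsCMField.complexConj F) • w).asIdeal, (AlgPoints.map (actΩOf S Kc 𝓜 w e I.univ I.act r y).hom.hom.hom Pt :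
                (fibreΩOf S Kc 𝓜 w e I.univ y).Points (AlgebraicClosure (w.adicCompletion F))) = 1) → IsIdealTorsionΩ S Kc 𝓜 w e I.univ I.act y 𝔞 Pt) →
            ∀ ⦃T : SchemeOver (geomResidueField w)⦄ (z : T ⟶ (sch₀Of 𝓜 w I.univ (red₀Of S Kc 𝓜 w h𝓨 e y)).X),
              z ≫ ψ = 1 → ∀ r ∈ 𝔞, z ≫ (act₀Of 𝓜 w I.univ I.act r (red₀Of S Kc 𝓜 w h𝓨 e y)).hom.hom.hom = 1) ∧
          -- (RK) the rank of `Ker ψ`, BY VALUE for every closed realisation (LA2-p04 (g2) (C6′) `hrkᵢ` text)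
          (∀ (K : SchemeOver (geomResidueField w)) [GrpObj K] [IsAffine K.left] [Module.Finite (geomResidueField w) (Alg K)]
            (κ : K ⟶ (sch₀Of 𝓜 w I.univ (red₀Of S Kc 𝓜 w h𝓨 e y)).X) [IsMonHom κ] [IsClosedImmersion κ.left],
            (∀ ⦃T : SchemeOver (geomResidueField w)⦄ (t : T ⟶ (sch₀Of 𝓜 w I.univ (red₀Of S Kc 𝓜 w h𝓨 e y)).X), (∃ s : T ⟶ K, s ≫ κ = t) ↔ t ≫ ψ = 1) →
            Module.finrank (geomResidueField w) (Alg K) = I.pChar ^ I.fDeg * I.pChar ^ I.fDeg) ∧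
          quotIncl (𝔡 (red₀Of S Kc 𝓜 w h𝓨 e y)).G₀ (spGeoOf I 𝔡 y L).1 ≫ (𝔡 (red₀Of S Kc 𝓜 w h𝓨 e y)).ι₀G ≫ ψ = 1 ∧
          ∀ ⦃T : SchemeOver (geomResidueField w)⦄ (t : T ⟶ (𝔡 (red₀Of S Kc 𝓜 w h𝓨 e y)).G₀),
            t ≫ (𝔡 (red₀Of S Kc 𝓜 w h𝓨 e y)).ι₀G ≫ ψ = 1 ↔
              ∃ s : T ⟶ specOver (geomResidueField w) (Alg (𝔡 (red₀Of S Kc 𝓜 w h𝓨 e y)).G₀ ⧸ (spGeoOf I 𝔡 y L).1),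
                s ≫ quotIncl (𝔡 (red₀Of S Kc 𝓜 w h𝓨 e y)).G₀ (spGeoOf I 𝔡 y L).1 = t)
    (x : AlgPoints (𝓜.localise w).reductionAt (geomResidueField w)) (hx : red₀Of S Kc 𝓜 w h𝓨 e y = x)
    (H : SubOf I 𝔡 x) (hH : hx ▸ spGeoOf I 𝔡 y L = H) :
    haveI := I.comm
    letI := (𝔡 x).grp₀
    haveI := (𝔡 x).aff₀
      ∃ (ψ : (sch₀Of 𝓜 w I.univ x).X ⟶ (sch₀Of 𝓜 w (serreTensor I.act E' hE') (red₀Of S Kc 𝓜 w h𝓨 e y'')).X) (_ : IsMonHom ψ),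
        (Flat ψ.left ∧ Function.Surjective ψ.left.base) ∧
        (∀ a : 𝓞 F, (act₀Of 𝓜 w I.univ I.act a x).hom.hom.hom ≫ ψ =
          ψ ≫ (act₀Of 𝓜 w (serreTensor I.act E' hE') (serreAction I.act E' hE') a (red₀Of S Kc 𝓜 w h𝓨 e y'')).hom.hom.hom) ∧
        (∀ a : Fin I.g ⊕ Fin I.g → ZMod I.N,
          AlgPoints.map ψ (lvlPt₀Of 𝓜 w I.univ I.lvl x a) =
            ((serreTensor I.act E' hE').baseChange (pullback.fst (𝓜.localise w).total.hom (specResidueField w))).restrictPt (red₀Of S Kc 𝓜 w h𝓨 e y'').left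
              ((serreTensor I.act E' hE').sectionBaseChange (pullback.fst (𝓜.localise w).total.hom (specResidueField w)) (I.lvl.section_ a ≫ serreTranslate I.act E' hE' P))) ∧
        (∀ (DBs : (sch₀Of 𝓜 w (serreTensor I.act E' hE') (red₀Of S Kc 𝓜 w h𝓨 e y'')).DualPair)
          (_ : Nonempty ((Scheme.Modules.pullback (DualPair.unitHatSlice DBs)).obj DBs.P ≅ SheafOfModules.unit _))
          (lamBs : (sch₀Of 𝓜 w (serreTensor I.act E' hE') (red₀Of S Kc 𝓜 w h𝓨 e y'')).X ⟶ DBs.hat.X) [IsMonHom lamBs],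
          (haveI := isMonHom_coverLeg (pullback.fst (𝓜.localise w).total.hom (specResidueField w)) (red₀Of S Kc 𝓜 w h𝓨 e y'').left I.act E' hE' P
           baseChangeHom (baseChangeHom (serreTranslate I.act E' hE' P) (pullback.fst (𝓜.localise w).total.hom (specResidueField w))) (red₀Of S Kc 𝓜 w h𝓨 e y'').left ≫ lamBs ≫
              DualPair.dualIsogenyOver (baseChangeHom (baseChangeHom (serreTranslate I.act E' hE' P) (pullback.fst (𝓜.localise w).total.hom (specResidueField w))) (red₀Of S Kc 𝓜 w h𝓨 e y'').left)
                (dual₀Of 𝓜 w I.univ I.dual (red₀Of S Kc 𝓜 w h𝓨 e y'')) DBs =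
            (pol₀Of 𝓜 w I.univ I.pol (red₀Of S Kc 𝓜 w h𝓨 e y'')).lam ≫ (dual₀Of 𝓜 w I.univ I.dual (red₀Of S Kc 𝓜 w h𝓨 e y'')).hat.mulN I.pChar) →
          ψ ≫ lamBs ≫ DualPair.dualIsogenyOver ψ (dual₀Of 𝓜 w I.univ I.dual x) DBs =
            (pol₀Of 𝓜 w I.univ I.pol x).lam ≫ (dual₀Of 𝓜 w I.univ I.dual x).hat.mulN I.pChar) ∧
        (∀ 𝔞 : Ideal (𝓞 F), (∀ Pt ∈ L.1, IsIdealTorsionΩ S Kc 𝓜 w e I.univ I.act y 𝔞 Pt) →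
          (∀ Pt : (fibreΩOf S Kc 𝓜 w e I.univ y).Points (AlgebraicClosure (w.adicCompletion F)),
            (∀ r ∈ w.asIdeal * ((IsCMField.complexConj F) • w).asIdeal, (AlgPoints.map (actΩOf S Kc 𝓜 w e I.univ I.act r y).hom.hom.hom Pt :
              (fibreΩOf S Kc 𝓜 w e I.univ y).Points (AlgebraicClosure (w.adicCompletion F))) = 1) → IsIdealTorsionΩ S Kc 𝓜 w e I.univ I.act y 𝔞 Pt) →
          ∀ ⦃T : SchemeOver (geomResidueField w)⦄ (z : T ⟶ (sch₀Of 𝓜 w I.univ x).X),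
            z ≫ ψ = 1 → ∀ r ∈ 𝔞, z ≫ (act₀Of 𝓜 w I.univ I.act r x).hom.hom.hom = 1) ∧
        -- (RK) the rank of `Ker ψ`, BY VALUE for every closed realisation (LA2-p04 (g2) (C6′) `hrkᵢ` text)
        (∀ (K : SchemeOver (geomResidueField w)) [GrpObj K] [IsAffine K.left] [Module.Finite (geomResidueField w) (Alg K)]
          (κ : K ⟶ (sch₀Of 𝓜 w I.univ x).X) [IsMonHom κ] [IsClosedImmersion κ.left],
          (∀ ⦃T : SchemeOver (geomResidueField w)⦄ (t : T ⟶ (sch₀Of 𝓜 w I.univ x).X), (∃ s : T ⟶ K, s ≫ κ = t) ↔ t ≫ ψ = 1) →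
          Module.finrank (geomResidueField w) (Alg K) = I.pChar ^ I.fDeg * I.pChar ^ I.fDeg) ∧
        quotIncl (𝔡 x).G₀ H.1 ≫ (𝔡 x).ι₀G ≫ ψ = 1 ∧
        ∀ ⦃T : SchemeOver (geomResidueField w)⦄ (t : T ⟶ (𝔡 x).G₀),
          t ≫ (𝔡 x).ι₀G ≫ ψ = 1 ↔
            ∃ s : T ⟶ specOver (geomResidueField w) (Alg (𝔡 x).G₀ ⧸ H.1), s ≫ quotIncl (𝔡 x).G₀ H.1 = t := by
  subst hx
  subst hH
  exact hdat

end QuotWDFold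

end Block_Q

end Summit.HodgeConjecture.HodgeConjecture.Cruxes.HLiu418.F0P6aLineSpecialisation

end
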